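import Summits.RiemannHypothesis.RiemannHypothesis.Theorems.SoloInformedLowFrequencyLaw
import HarnessLib

/-!
# Separated zeros near a large value bound Weil's form from below (solo-informed T66)

The one-step sampling principle behind T62 (`ε(a) > 0` under RH) and T65 (the double-exponential
lower law for low-frequency tests), stated with a FREE radius so that any supply of separated
critical zeros — Selberg's dyadic blocks, or conjecturally every short window — can be fed in:

* `weilQuadratic_re_ge_of_separated_zeros` — under RH, let `g` be smooth with
  `tsupport g ⊆ [-a, a]`, `‖g‖₂ = 1`, and `|ĝ(½ + it₀)| ≥ m ≥ 0`. If `S` is a finite set of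
  ordinates `γ ≠ 0` of critical zeros with `|γ − t₀| ≤ r`, pairwise `≥ d` apart, and numerous
  enough that the growth term is harmless, `e^{3ra} √(2a) / 2^{#S} ≤ m/2`, then
  `Re Q(g) ≥ (m / (4 #S))² · (d / (4r))^{2(#S − 1)}`.
  In words: `log(1/Q) ≤ 2 log(4N/m) + 2(N−1) log(4r/d)` as soon as `N ≳ (3ra + log(1/m))/log 2`
  separated zeros sit within `r` of a value of size `m`; the lower size law for Weil's form under
  RH is thereby reduced to the windowed count of SEPARATED zeros (Selberg's window `≍` height
  gives T62/T65; separated zeros at density `log V` in every window of length `V` would give the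
  double-exponential law with the spectral bulk as high as the ceiling allows).
* `weilQuadratic_re_ge_exp_neg_of_lowFrequency` — the LOW-FREQUENCY GROUND-ENERGY LAW (corollary
  of T65 `weilQuadratic_re_ge_exp_neg_of_large_value`): under RH there are `C₁, C₂ > 0` with
  `Re Q(g) ≥ exp(−C₂ a w log w)`, `w := max(T, e^{C₁ a})`, for every unit test `g` on `[-a, a]`
  (`a ≥ 1`) carrying spectral mass `∫_{(-T,T)} |ĝ(½+it)|² ≥ π` below height `T ≥ 1` (half of
  `‖ĝ‖² = 2π`): double-exponential in `a` for `T ≤ e^{O(a)}`, the true shape of Weil's ground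
  energy (upper law `exp(−c e^{2a}/a)`, T2), whereas without the frequency cap only the
  triple-exponential bound of T62 is available from the tree's zero statistics.

Proof: T62a `norm_le_of_small_on_separated_nodes` at `s₀ = ½ + it₀` with the nodes `½ + iγ`,
radius `r`, circle bound `|ĝ(s)| ≤ e^{a|Re s − ½|}√(2a) ≤ e^{3ra}√(2a)`
(`norm_weilMellin_le_window`) and node values `≤ √(Re Q)` by termwise positivity under RH
(`sum_norm_sq_weilMellin_le_re_weilQuadratic`).

References: E. Bombieri, Rend. Mat. Acc. Lincei (9) 11 (2000) §3 (key `Bombieri2000Weil`) for the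
explicit formula; the estimate is new in this form. [new]
-/

noncomputable section

open Complex Set MeasureTheory
open Literature.NumberTheory.LFunctions
open scoped Real

namespace Summit.RiemannHypothesis.RiemannHypothesis.Theorems

/-- **Separated zeros near a large value.** Under RH, for smooth `g` with `tsupport g ⊆ [-a, a]`,
`‖g‖₂ = 1` and `|ĝ(½ + it₀)| ≥ m ≥ 0`: if `S` is a finite set of ordinates `γ ≠ 0` of critical
zeros within `r` of `t₀`, pairwise `≥ d` apart, with `e^{3ra}√(2a)/2^{#S} ≤ m/2`, then
`(m/(4 #S))² ((d/(4r))^{#S−1})² ≤ Re Q(g)`. [new] -/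
theorem weilQuadratic_re_ge_of_separated_zeros (hRH : RiemannHypothesis) {g : ℝ → ℂ}
    (hg : IsWeilTest g) {a : ℝ} (ha : 0 < a) (hsupp : tsupport g ⊆ Icc (-a) a)
    (hnorm : ∫ t, ‖g t‖ ^ 2 = (1 : ℝ)) {t₀ r d m : ℝ} (hr : 0 < r) (hd : 0 < d) (hm0 : 0 ≤ m)
    (hm : m ≤ ‖weilMellin g (1 / 2 + t₀ * I)‖) (S : Finset ℝ)
    (hS : ∀ γ ∈ S, γ ≠ 0 ∧ |γ - t₀| ≤ r ∧ riemannZeta (1 / 2 + γ * I) = 0)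
    (hsep : ∀ γ ∈ S, ∀ γ' ∈ S, γ ≠ γ' → d ≤ |γ - γ'|)
    (hgrowth : Real.exp (3 * r * a) * Real.sqrt (2 * a) / 2 ^ S.card ≤ m / 2) :
    (m / (4 * S.card)) ^ 2 * ((d / (4 * r)) ^ (S.card - 1)) ^ 2 ≤ (weilQuadratic g).re := by
  classical
  -- the zero side under RH: node values are `≤ √(Re Q)`
  have hS0 : ∀ γ ∈ S, γ ≠ 0 := fun γ hγ ↦ (hS γ hγ).1
  have hsum := sum_norm_sq_weilMellin_le_re_weilQuadratic hRH hg S hS0 fun γ hγ ↦ (hS γ hγ).2.2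
  have hQ0 : 0 ≤ (weilQuadratic g).re :=
    le_trans (Finset.sum_nonneg fun x _ ↦ sq_nonneg _) hsum
  rcases Nat.eq_zero_or_pos S.card with hN0 | hNpos
  · rw [hN0]; simpa using hQ0
  obtain ⟨η, hη⟩ : ∃ η : ℝ, η = Real.sqrt (weilQuadratic g).re := ⟨_, rfl⟩
  have hη0 : 0 ≤ η := by rw [hη]; exact Real.sqrt_nonneg _
  have hηsq : η ^ 2 = (weilQuadratic g).re := by rw [hη, Real.sq_sqrt hQ0]
  -- nodes on the critical line
  obtain ⟨ρ, hρ⟩ : ∃ ρ : ℝ → ℂ, ρ = fun γ : ℝ ↦ (1 / 2 : ℂ) + (γ : ℂ) * I := ⟨_, rfl⟩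
  have hρnorm : ∀ x y : ℝ, ‖ρ x - ρ y‖ = |x - y| := fun x y ↦ by
    have e : ρ x - ρ y = ((x - y : ℝ) : ℂ) * I := by rw [hρ]; push_cast; ring
    rw [e, norm_mul, Complex.norm_I, mul_one, Complex.norm_real, Real.norm_eq_abs]
  have hρinj : Function.Injective ρ := fun x y h ↦ by
    have h' : ‖ρ x - ρ y‖ = 0 := by rw [h, sub_self, norm_zero]
    rw [hρnorm] at h'
    exact eq_of_abs_sub_eq_zero h'
  obtain ⟨Z, hZ⟩ : ∃ Z : Finset ℂ, Z = S.image ρ := ⟨_, rfl⟩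
  have hZcard : Z.card = S.card := by rw [hZ]; exact Finset.card_image_of_injective S hρinj
  have hZr : ∀ z ∈ Z, ‖z - ρ t₀‖ ≤ r := by
    intro z hz
    rw [hZ] at hz
    obtain ⟨γ, hγ, rfl⟩ := Finset.mem_image.1 hz
    rw [hρnorm]
    exact (hS γ hγ).2.1
  have hZsep : ∀ z ∈ Z, ∀ w ∈ Z, z ≠ w → d ≤ ‖z - w‖ := by
    intro z hz w hw hzw
    rw [hZ] at hz hw
    obtain ⟨γ, hγ, rfl⟩ := Finset.mem_image.1 hz
    obtain ⟨γ', hγ', rfl⟩ := Finset.mem_image.1 hw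
    rw [hρnorm]
    exact hsep γ hγ γ' hγ' fun h ↦ hzw (h ▸ rfl)
  have hZη : ∀ z ∈ Z, ‖weilMellin g z‖ ≤ η := by
    intro z hz
    rw [hZ] at hz
    obtain ⟨γ, hγ, rfl⟩ := Finset.mem_image.1 hz
    have h1 : ‖weilMellin g (1 / 2 + γ * I)‖ ^ 2 ≤
        ∑ x ∈ S, ‖weilMellin g (1 / 2 + x * I)‖ ^ 2 :=
      Finset.single_le_sum (f := fun x : ℝ ↦ ‖weilMellin g (1 / 2 + x * I)‖ ^ 2)
        (fun x _ ↦ sq_nonneg _) hγ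
    have h2 : ‖weilMellin g (ρ γ)‖ ^ 2 ≤ (weilQuadratic g).re := by
      rw [hρ]; exact h1.trans hsum
    calc ‖weilMellin g (ρ γ)‖ = Real.sqrt (‖weilMellin g (ρ γ)‖ ^ 2) :=
          (Real.sqrt_sq (norm_nonneg _)).symm
      _ ≤ Real.sqrt (weilQuadratic g).re := Real.sqrt_le_sqrt h2
      _ = η := hη.symm
  have hM : ∀ s : ℂ, ‖s - ρ t₀‖ = 3 * r →
      ‖weilMellin g s‖ ≤ Real.exp (3 * r * a) * Real.sqrt (2 * a) := by
    intro s hs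
    have h1 := norm_weilMellin_le_window hg hsupp ha.le s
    rw [hnorm, Real.sqrt_one, mul_one] at h1
    refine h1.trans (mul_le_mul_of_nonneg_right ?_ (Real.sqrt_nonneg _))
    rw [Real.exp_le_exp]
    have h2 : |s.re - 1 / 2| ≤ 3 * r := by
      have e : s.re - 1 / 2 = (s - ρ t₀).re := by simp [hρ]
      rw [e]
      exact (Complex.abs_re_le_norm _).trans hs.le
    nlinarith
  have key := norm_le_of_small_on_separated_nodes
    (differentiable_weilMellin hg.1.continuous hg.2) (ρ t₀) Z hr hd hη0 hZr hZsep hZη hM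
  rw [hZcard] at key
  have hs₀ : weilMellin g (ρ t₀) = weilMellin g (1 / 2 + t₀ * I) := by rw [hρ]
  rw [hs₀] at key
  -- `m ≤ m/2 + 2 N η X`, hence `m (d/4r)^{N-1} / (4N) ≤ η`
  obtain ⟨X, hX⟩ : ∃ X : ℝ, X = (4 * r / d) ^ (S.card - 1) := ⟨_, rfl⟩
  obtain ⟨c, hc⟩ : ∃ c : ℝ, c = (d / (4 * r)) ^ (S.card - 1) := ⟨_, rfl⟩
  have hc0 : 0 < c := by rw [hc]; positivity
  have hXc : X * c = 1 := by
    rw [hX, hc, ← mul_pow]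
    have : 4 * r / d * (d / (4 * r)) = 1 := by field_simp
    rw [this, one_pow]
  have hN : (0 : ℝ) < S.card := by exact_mod_cast hNpos
  have hmle : m ≤ 4 * S.card * η * X := by
    rw [hX]
    have := hm.trans (key.trans (add_le_add hgrowth le_rfl))
    linarith
  have hroot : m / (4 * S.card) * c ≤ η := by
    have h1 : m / (4 * S.card) ≤ η * X := by
      rw [div_le_iff₀ (by positivity)]
      linarith
    calc m / (4 * S.card) * c ≤ η * X * c := mul_le_mul_of_nonneg_right h1 hc0.le
      _ = η := by rw [mul_assoc, hXc, mul_one]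
  have hroot0 : 0 ≤ m / (4 * S.card) * c := by positivity
  calc (m / (4 * S.card)) ^ 2 * ((d / (4 * r)) ^ (S.card - 1)) ^ 2
      = (m / (4 * S.card) * c) ^ 2 := by rw [hc]; ring
    _ ≤ η ^ 2 := pow_le_pow_left₀ hroot0 hroot 2
    _ = (weilQuadratic g).re := hηsq

/-- **Low-frequency ground-energy law (RH).** There are `C₁, C₂ > 0` such that every unit test `g`
on `[-a, a]`, `a ≥ 1`, with spectral mass `∫_{(-T,T)} |ĝ(½+it)|² ≥ π` below height `T ≥ 1` has
`Re Q(g) ≥ exp(−C₂ · a · w · log w)`, `w = max(T, e^{C₁ a})`. [new] -/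
theorem weilQuadratic_re_ge_exp_neg_of_lowFrequency (hRH : RiemannHypothesis) :
    ∃ C₁ C₂ : ℝ, 0 < C₁ ∧ 0 < C₂ ∧ ∀ a : ℝ, 1 ≤ a → ∀ g : ℝ → ℂ, IsWeilTest g →
      tsupport g ⊆ Icc (-a) a → ∫ t, ‖g t‖ ^ 2 = (1 : ℝ) → ∀ T : ℝ, 1 ≤ T →
      π ≤ ∫ t in Ioo (-T) T, ‖weilMellin g (1 / 2 + t * I)‖ ^ 2 →
        Real.exp (-(C₂ * a * max T (Real.exp (C₁ * a)) *
          Real.log (max T (Real.exp (C₁ * a))))) ≤ (weilQuadratic g).re := by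
  obtain ⟨C₁, C₂, hC₁, hC₂, hmain⟩ := weilQuadratic_re_ge_exp_neg_of_large_value hRH
  refine ⟨C₁, C₂, hC₁, hC₂, fun a ha g hg hsupp hnorm T hT hmass ↦ ?_⟩
  obtain ⟨w, hw⟩ : ∃ w : ℝ, w = max T (Real.exp (C₁ * a)) := ⟨_, rfl⟩
  have hTw : T ≤ w := hw ▸ le_max_left _ _
  have hw1 : Real.exp (C₁ * a) ≤ w := hw ▸ le_max_right _ _
  -- a large value below height `T`
  obtain ⟨t₀, ht₀, hval⟩ :
      ∃ t₀ : ℝ, |t₀| < T ∧ π / (4 * T) ≤ ‖weilMellin g (1 / 2 + t₀ * I)‖ ^ 2 := by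
    by_contra hcon
    push Not at hcon
    have hfi : IntegrableOn (fun t : ℝ ↦ ‖weilMellin g (1 / 2 + t * I)‖ ^ 2) (Ioo (-T) T) :=
      (integrable_norm_sq_weilMellin_half_line hg).integrableOn
    have hle : ∫ t in Ioo (-T) T, ‖weilMellin g (1 / 2 + t * I)‖ ^ 2 ≤
        ∫ _t in Ioo (-T) T, π / (4 * T) := by
      refine setIntegral_mono_on hfi (integrableOn_const (by simp [Real.volume_Ioo]))
        measurableSet_Ioo fun t ht ↦ ?_
      exact (hcon t (abs_lt.2 ⟨ht.1, ht.2⟩)).le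
    have hconst : ∫ _t in Ioo (-T) T, π / (4 * T) = π / 2 := by
      rw [setIntegral_const, Real.volume_real_Ioo_of_le (by linarith), smul_eq_mul]
      field_simp
      ring
    rw [hconst] at hle
    linarith [Real.pi_pos]
  -- it is at least `e^{-aw}`
  have hm : Real.exp (-(a * w)) ≤ ‖weilMellin g (1 / 2 + t₀ * I)‖ := by
    by_contra hlt
    push Not at hlt
    have h1 : ‖weilMellin g (1 / 2 + t₀ * I)‖ ^ 2 < Real.exp (-(a * w)) ^ 2 :=
      pow_lt_pow_left₀ hlt (norm_nonneg _) two_ne_zero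
    have h2 : Real.exp (-(a * w)) ^ 2 = Real.exp (-(2 * a * w)) := by
      rw [← Real.exp_nat_mul]; congr 1; push_cast; ring
    have h3 : 2 * w + 1 ≤ Real.exp (2 * a * w) := by
      have h4 := Real.add_one_le_exp (2 * w)
      have h5 : Real.exp (2 * w) ≤ Real.exp (2 * a * w) := Real.exp_le_exp.2 (by nlinarith)
      linarith
    have h6 : 3 * Real.exp (2 * a * w) ≤ Real.exp (2 * a * w) * π := by
      nlinarith [Real.pi_gt_three, Real.exp_pos (2 * a * w)]
    have h7 : Real.exp (-(2 * a * w)) ≤ π / (4 * T) := by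
      rw [Real.exp_neg, le_div_iff₀ (by positivity), inv_mul_le_iff₀ (Real.exp_pos _)]
      linarith
    linarith
  have := hmain a ha g hg hsupp hnorm w t₀ hw1 (ht₀.le.trans hTw) hm
  rw [← hw]
  exact this

end Summit.RiemannHypothesis.RiemannHypothesis.Theorems
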